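import Summits.ResolutionOfSingularities.ResolutionOfSingularities.Theorems.FrobeniusLadderFInjectiveMacaulayficationFHalfRowOfToricCoverData
import HarnessLib

/-!
# Cover-data cost reduction: the `VertexMinimises` binder `hge` over `A = 𝔪·B` from VERTEX-ONLY checks + one global dominance table
# (crux `FInjectiveMacaulayfication` stmt-ResolutionOfSingularities-15315, chain w45a; res-L1-w45a-stub-3 g11's OPEN COST ISSUE l.≈83160 «hge over A = 𝔪·B: |B| ≈ 1.9k × 327 charts × 5
# ≈ 3·10⁶ kernel comparisons»; seat res-L1-w45a-stub-1 g12 (consumer-side glue for ✓ p655852 / ✓ p657751 `fHalfRow_of_toricCoverData(_weak)`))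

[OURS · L1 W4.5a] Support file (`--supports stmt-ResolutionOfSingularities-15315 --as helper`); def-free; UNCONDITIONAL; no named fact; elementary lattice arithmetic.
AI-written (AI review is weaker than expert review).

* §1 `mulVec_le_of_dominance` / ★ `hge_of_dominance` — ONE chart `(V, b₀)`: if `V·b₀ ≤ V·v` for the finitely many `v ∈ Vert` (per-chart vertex checks) and every `b ∈ B` DOMINATES A
  CONVEX COMBINATION of `Vert` (`N • b = Σ_{v∈Vert} λ_v • v + r'`, `Σ λ_v = N > 0` — ONE record per `b`, chart-independent, decided once), then `V·b₀ ≤ V·b` for all `b ∈ B`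
  (rows of `V` are `ℕ`-valued: `N·(V b) = Σ λ_v·(V v) + V r' ≥ N·(V b₀)`).
* §2 ★ `hge_product` — the product centre `A = {e_i + b : i, b ∈ B}` with chart vertex `m = e_{i₀} + b₀`: from the COLUMN check `V r i₀ ≤ V r i` (all rows `r`, all `i`) and §1's
  conclusion for `b₀` over `B`, the binder `hge : ∀ e ∈ A, symm(V *ᵥ m) ≤ symm(V *ᵥ e)` of `CICertificates.ciCertificates(_of_isPrime)` / `fHalfRow_of_toricCoverData` VERBATIM.
Cost after reduction: per chart `5·(|Vert| + 5)` comparisons + `|B|` dominance records once, instead of `5·|A|` comparisons per chart.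
[folklore]
-/

-- single-problem summit: the doubled namespace component is forced
set_option linter.dupNamespace false

noncomputable section

open MvPolynomial

namespace Summit.ResolutionOfSingularities.ResolutionOfSingularities.Theorems.FInjectiveMacaulayfication.CoverDataHgeReduction

open Summit.ResolutionOfSingularities.ResolutionOfSingularities.Theorems.FInjectiveMacaulayfication

variable {n : ℕ}

/-! ## §1 One chart: vertex checks + dominance records ⇒ `hge` over `B` -/

/-- `V *ᵥ` is additive and `ℕ`-homogeneous on exponent vectors (coerced finsupps). [plumbing] -/
theorem mulVec_coe_add (V : Matrix (Fin n) (Fin n) ℕ) (a b : Fin n →₀ ℕ) :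
    V.mulVec ⇑(a + b) = V.mulVec ⇑a + V.mulVec ⇑b := by
  rw [Finsupp.coe_add, Matrix.mulVec_add]

/-- [plumbing] -/
theorem mulVec_coe_smul (V : Matrix (Fin n) (Fin n) ℕ) (N : ℕ) (a : Fin n →₀ ℕ) :
    V.mulVec ⇑(N • a) = N • V.mulVec ⇑a := by
  rw [Finsupp.coe_smul, Matrix.mulVec_smul]

/-- [plumbing] -/
theorem mulVec_coe_sum {ι : Type} (s : Finset ι) (V : Matrix (Fin n) (Fin n) ℕ) (f : ι → (Fin n →₀ ℕ)) :
    V.mulVec ⇑(∑ v ∈ s, f v) = ∑ v ∈ s, V.mulVec ⇑(f v) := by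
  classical
  induction s using Finset.induction_on with
  | empty => simp
  | @insert c s hc ih => rw [Finset.sum_insert hc, Finset.sum_insert hc, mulVec_coe_add, ih]

/-- **Dominance ⇒ weight inequality** (one row functional at a time, all rows at once as vectors): if `V·b₀ ≤ V·v` for all `v ∈ Vert` and
`N • b = Σ_{v∈Vert} λ_v • v + r'` with `Σ λ_v = N`, then `N • (V·b₀) ≤ N • (V·b)`. [folklore] -/
theorem smul_mulVec_le_of_dominance (V : Matrix (Fin n) (Fin n) ℕ) (Vert : Finset (Fin n →₀ ℕ)) (b₀ : Fin n →₀ ℕ)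
    (hvert : ∀ v ∈ Vert, V.mulVec ⇑b₀ ≤ V.mulVec ⇑v) (b : Fin n →₀ ℕ) (N : ℕ) (lam : (Fin n →₀ ℕ) → ℕ) (r' : Fin n →₀ ℕ)
    (hsum : (∑ v ∈ Vert, lam v) = N) (hrec : N • b = (∑ v ∈ Vert, lam v • v) + r') :
    N • V.mulVec ⇑b₀ ≤ V.mulVec ⇑(N • b) := by
  rw [hrec, mulVec_coe_add, mulVec_coe_sum]
  calc N • V.mulVec ⇑b₀ = ∑ v ∈ Vert, lam v • V.mulVec ⇑b₀ := by rw [← Finset.sum_smul, hsum]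
    _ ≤ ∑ v ∈ Vert, V.mulVec ⇑(lam v • v) := Finset.sum_le_sum fun v hv => by
        rw [mulVec_coe_smul]
        exact smul_le_smul_of_nonneg_left (hvert v hv) (Nat.zero_le _)
    _ ≤ (∑ v ∈ Vert, V.mulVec ⇑(lam v • v)) + V.mulVec ⇑r' := le_add_of_nonneg_right (fun i => Nat.zero_le _)

/-- ★ **`hge` over `B` from VERTEX CHECKS + DOMINANCE RECORDS.** [folklore] -/
theorem hge_of_dominance (V : Matrix (Fin n) (Fin n) ℕ) (Vert B : Finset (Fin n →₀ ℕ)) (b₀ : Fin n →₀ ℕ)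
    (hvert : ∀ v ∈ Vert, (Finsupp.equivFunOnFinite.symm (V.mulVec ⇑b₀) : Fin n →₀ ℕ) ≤ Finsupp.equivFunOnFinite.symm (V.mulVec ⇑v))
    (hdom : ∀ b ∈ B, ∃ (N : ℕ) (lam : (Fin n →₀ ℕ) → ℕ) (r' : Fin n →₀ ℕ), 0 < N ∧ (∑ v ∈ Vert, lam v) = N ∧ N • b = (∑ v ∈ Vert, lam v • v) + r') :
    ∀ b ∈ B, (Finsupp.equivFunOnFinite.symm (V.mulVec ⇑b₀) : Fin n →₀ ℕ) ≤ Finsupp.equivFunOnFinite.symm (V.mulVec ⇑b) := by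
  intro b hb
  obtain ⟨N, lam, r', hN, hsum, hrec⟩ := hdom b hb
  have hvert' : ∀ v ∈ Vert, V.mulVec ⇑b₀ ≤ V.mulVec ⇑v := fun v hv i => by
    have := hvert v hv i
    simpa using this
  have key := smul_mulVec_le_of_dominance V Vert b₀ hvert' b N lam r' hsum hrec
  rw [mulVec_coe_smul] at key
  intro i
  have hi := key i
  simp only [Pi.smul_apply, smul_eq_mul] at hi
  show (Finsupp.equivFunOnFinite.symm (V.mulVec ⇑b₀)) i ≤ (Finsupp.equivFunOnFinite.symm (V.mulVec ⇑b)) i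
  simpa using Nat.le_of_mul_le_mul_left hi hN

/-! ## §2 The product centre `A = 𝔪·B` -/

/-- `V·e_i` is the `i`-th column of `V`. [plumbing] -/
theorem mulVec_single_one (V : Matrix (Fin n) (Fin n) ℕ) (i r : Fin n) :
    V.mulVec ⇑(Finsupp.single i 1) r = V r i := by
  classical
  rw [Matrix.mulVec, dotProduct]
  simp [Finsupp.single_apply]

/-- ★ **`hge` over the PRODUCT centre `A = {e_i + b}`** with vertex `m = e_{i₀} + b₀`: from the column check `V r i₀ ≤ V r i` and `hge` over `B` at `b₀`. [folklore] -/
theorem hge_product (V : Matrix (Fin n) (Fin n) ℕ) (B A : Finset (Fin n →₀ ℕ))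
    (hA : A = (Finset.univ ×ˢ B).image (fun q : Fin n × (Fin n →₀ ℕ) => Finsupp.single q.1 1 + q.2))
    (i₀ : Fin n) (b₀ : Fin n →₀ ℕ) (hcol : ∀ r i : Fin n, V r i₀ ≤ V r i)
    (hB : ∀ b ∈ B, (Finsupp.equivFunOnFinite.symm (V.mulVec ⇑b₀) : Fin n →₀ ℕ) ≤ Finsupp.equivFunOnFinite.symm (V.mulVec ⇑b)) :
    ∀ e ∈ A, (Finsupp.equivFunOnFinite.symm (V.mulVec ⇑((Finsupp.single i₀ 1 + b₀ : Fin n →₀ ℕ))) : Fin n →₀ ℕ) ≤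
      Finsupp.equivFunOnFinite.symm (V.mulVec ⇑e) := by
  classical
  intro e he
  rw [hA, Finset.mem_image] at he
  obtain ⟨⟨i, b⟩, hq, rfl⟩ := he
  have hb : b ∈ B := (Finset.mem_product.mp hq).2
  intro r
  have h1 := hB b hb r
  rw [Finsupp.coe_equivFunOnFinite_symm, Finsupp.coe_equivFunOnFinite_symm] at h1 ⊢
  rw [mulVec_coe_add, mulVec_coe_add, Pi.add_apply, Pi.add_apply, mulVec_single_one, mulVec_single_one]
  exact add_le_add (hcol r i) h1

/-- The same with the vertex GIVEN as an element `m` and an equation `m = e_{i₀} + b₀` (the shape the data modules emit). [folklore] -/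
theorem hge_product' (V : Matrix (Fin n) (Fin n) ℕ) (B A : Finset (Fin n →₀ ℕ))
    (hA : A = (Finset.univ ×ˢ B).image (fun q : Fin n × (Fin n →₀ ℕ) => Finsupp.single q.1 1 + q.2))
    (m : Fin n →₀ ℕ) (i₀ : Fin n) (b₀ : Fin n →₀ ℕ) (hm : m = Finsupp.single i₀ 1 + b₀) (hcol : ∀ r i : Fin n, V r i₀ ≤ V r i)
    (Vert : Finset (Fin n →₀ ℕ))
    (hvert : ∀ v ∈ Vert, (Finsupp.equivFunOnFinite.symm (V.mulVec ⇑b₀) : Fin n →₀ ℕ) ≤ Finsupp.equivFunOnFinite.symm (V.mulVec ⇑v))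
    (hdom : ∀ b ∈ B, ∃ (N : ℕ) (lam : (Fin n →₀ ℕ) → ℕ) (r' : Fin n →₀ ℕ), 0 < N ∧ (∑ v ∈ Vert, lam v) = N ∧ N • b = (∑ v ∈ Vert, lam v • v) + r') :
    ∀ e ∈ A, (Finsupp.equivFunOnFinite.symm (V.mulVec ⇑m) : Fin n →₀ ℕ) ≤ Finsupp.equivFunOnFinite.symm (V.mulVec ⇑e) := by
  rw [hm]
  exact hge_product V B A hA i₀ b₀ hcol (hge_of_dominance V Vert B b₀ hvert hdom)

/-! ## §3 The chart-indexed form: the MULTI-VERTEX COVER RECORDS are dominance records (res-L1-w45a-stub-3 g11's emitter shape) -/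

/-- ★ **`hge` over `B` from the per-chart VERTEX comparison + the multi-vertex COVER RECORDS** (res-L1-w45a-stub-2's `hcov_of_multiRecord` currency, indexed by charts):
if `V·(m c₀) ≤ V·(m c)` for every chart `c` (`t` checks) and every `b ∈ B` has a record `(Σ_c cnt c) • b = Σ_c cnt c • m c + r'` with `Σ_c cnt c > 0` (one record per `b`,
chart-independent), then `V·(m c₀) ≤ V·b` for all `b ∈ B`. [folklore] -/
theorem hge_of_coverRecords {t : ℕ} (V : Matrix (Fin n) (Fin n) ℕ) (m : Fin t → (Fin n →₀ ℕ)) (c₀ : Fin t) (B : Finset (Fin n →₀ ℕ))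
    (hvert : ∀ c : Fin t, (Finsupp.equivFunOnFinite.symm (V.mulVec ⇑(m c₀)) : Fin n →₀ ℕ) ≤ Finsupp.equivFunOnFinite.symm (V.mulVec ⇑(m c)))
    (hrec : ∀ b ∈ B, ∃ (cnt : Fin t → ℕ) (r' : Fin n →₀ ℕ), 0 < (∑ c, cnt c) ∧ (∑ c, cnt c) • b = (∑ c, cnt c • m c) + r') :
    ∀ b ∈ B, (Finsupp.equivFunOnFinite.symm (V.mulVec ⇑(m c₀)) : Fin n →₀ ℕ) ≤ Finsupp.equivFunOnFinite.symm (V.mulVec ⇑b) := by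
  intro b hb
  obtain ⟨cnt, r', hN, hrec'⟩ := hrec b hb
  have hvert' : ∀ c : Fin t, V.mulVec ⇑(m c₀) ≤ V.mulVec ⇑(m c) := fun c i => by
    have := hvert c i
    simpa using this
  have key : (∑ c, cnt c) • V.mulVec ⇑(m c₀) ≤ V.mulVec ⇑((∑ c, cnt c) • b) := by
    rw [hrec', mulVec_coe_add, mulVec_coe_sum]
    calc (∑ c, cnt c) • V.mulVec ⇑(m c₀) = ∑ c, cnt c • V.mulVec ⇑(m c₀) := by rw [← Finset.sum_smul]
      _ ≤ ∑ c, V.mulVec ⇑(cnt c • m c) := Finset.sum_le_sum fun c _ => by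
          rw [mulVec_coe_smul]
          exact smul_le_smul_of_nonneg_left (hvert' c) (Nat.zero_le _)
      _ ≤ (∑ c, V.mulVec ⇑(cnt c • m c)) + V.mulVec ⇑r' := le_add_of_nonneg_right (fun i => Nat.zero_le _)
  rw [mulVec_coe_smul] at key
  intro i
  have hi := key i
  simp only [Pi.smul_apply, smul_eq_mul] at hi
  show (Finsupp.equivFunOnFinite.symm (V.mulVec ⇑(m c₀))) i ≤ (Finsupp.equivFunOnFinite.symm (V.mulVec ⇑b)) i
  simpa using Nat.le_of_mul_le_mul_left hi hN

/-- ★ **Chart-indexed product form**: `A = 𝔪·B`, chart vertex `m c₀ = e_{i₀} + b₀`, column check + vertex comparison over charts + cover records for `B` (with vertices `mB c`,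
the `B`-parts of the chart vertices) ⇒ the `hge` binder over `A` VERBATIM. [folklore] -/
theorem hge_product_of_coverRecords {t : ℕ} (V : Matrix (Fin n) (Fin n) ℕ) (B A : Finset (Fin n →₀ ℕ))
    (hA : A = (Finset.univ ×ˢ B).image (fun q : Fin n × (Fin n →₀ ℕ) => Finsupp.single q.1 1 + q.2))
    (m : Fin n →₀ ℕ) (i₀ : Fin n) (mB : Fin t → (Fin n →₀ ℕ)) (c₀ : Fin t) (hm : m = Finsupp.single i₀ 1 + mB c₀) (hcol : ∀ r i : Fin n, V r i₀ ≤ V r i)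
    (hvert : ∀ c : Fin t, (Finsupp.equivFunOnFinite.symm (V.mulVec ⇑(mB c₀)) : Fin n →₀ ℕ) ≤ Finsupp.equivFunOnFinite.symm (V.mulVec ⇑(mB c)))
    (hrec : ∀ b ∈ B, ∃ (cnt : Fin t → ℕ) (r' : Fin n →₀ ℕ), 0 < (∑ c, cnt c) ∧ (∑ c, cnt c) • b = (∑ c, cnt c • mB c) + r') :
    ∀ e ∈ A, (Finsupp.equivFunOnFinite.symm (V.mulVec ⇑m) : Fin n →₀ ℕ) ≤ Finsupp.equivFunOnFinite.symm (V.mulVec ⇑e) := by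
  rw [hm]
  exact hge_product V B A hA i₀ (mB c₀) hcol (hge_of_coverRecords V mB c₀ B hvert hrec)

end Summit.ResolutionOfSingularities.ResolutionOfSingularities.Theorems.FInjectiveMacaulayfication.CoverDataHgeReduction

end
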